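/-
Copyright (c) 2026. All rights reserved.
Released under Apache 2.0 license as described in the file LICENSE.
Authors: HodgeCM publication cell (pub-hodgecm), GR lane, seat GR-2 (`pub-hodgecm-own-hyp34`).
-/
import Literature.NumberTheory.Weil1964.AdelicMetaplecticThetaMajorants
import Mathlib.Analysis.SpecialFunctions.JapaneseBracket
import Mathlib.MeasureTheory.Integral.Lebesgue.DominatedConvergence
import HarnessLib

/-!
# `L²`-continuity of `h ↦ ω_ψ(s h) Φ` along a continuous homomorphism into `Mp_ψ(W_𝐀)ᶜᵒⁿᵗ`

Topic `NumberTheory/Weil1964`; namespace `Literature.NumberTheory.Weil1964`.  KERNEL ONLY: theorems, no definition, no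
named fact, nothing of [Weil1964] or [GelbartRogawski1991] asserted.

[Weil1964, Chap. III n° 41, Lemme 5 p. 192]: on a compact subset of the metaplectic group the functions `SΦ`
(`Φ ∈ 𝒮(X_A)`) are dominated by ONE Schwartz–Bruhat function.  The tree's reproduction of that lemma along a continuous
homomorphism `s : H → Mp_ψ(W_𝐀)ᶜᵒⁿᵗ` admitting an archimedean covariant family
(`AdelicMetaplecticThetaMajorants.decay_near`: near every `h₀`, all `ω(s h)Φ` obey one bound `M (1 + ‖x_∞‖)^{-k}` and
vanish off one compact set of finite parts, for every `k`) was written for the theta series; this file draws the `L²`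
consequence that [GelbartRogawski1991, §3.1 p. 454 L21–27, Prop. 3.1.1 p. 455 L1–2] needs when `ρ_ψ` is realised on the
HILBERT space `L²(𝐀_Fⁿ)` ("`M_g` is an operator on the space of `ρ_ψ`", "continuous section"):

* **`tendsto_eLpNorm_omega_comp_sub`** — for every Haar measure `ν` on `𝐀_Fⁿ` and every `Φ ∈ 𝒮(𝐀_Fⁿ)`,
  `‖ω(s h)Φ − ω(s h₀)Φ‖_{L²(ν)} → 0` as `h → h₀` (dominated convergence: the majorant
  `2M (1 + ‖x_∞‖)^{-k} 𝟙_{C_f}(x_f)` is square-integrable for `2k > n [F:ℚ]`, and the matrix coefficients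
  `h ↦ (ω(s h)Φ)(x)` are continuous by definition of the coefficient topology);
* **`continuous_toL2_omega_comp`** — consequently, for any linear map `i : 𝒮(𝐀_Fⁿ) →ₗ[ℂ] L²(𝐀_Fⁿ, ν)` sending a
  function to its class (`i Φ =ᵐ Φ`), every orbit map `h ↦ i (ω(s h) Φ)` is CONTINUOUS in `L²` — the strong
  continuity along `s` consumed by the unitary leg (`AdelicMetaplecticUnitaryLeg.continuous_toOp_unitaryLeg_comp_apply`)
  and hence by the "continuous section" clause of [GelbartRogawski1991, Prop. 3.1.1] for the `L²` model.

`H` is assumed first countable (e.g. `U(𝐀)`), so that dominated convergence applies along `𝓝 h₀`.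

## References
* [Weil1964] A. Weil, Acta Math. 111 (1964) 143–211, Chap. III n° 39 p. 189, n° 41 Lemme 5 p. 192.
* [GelbartRogawski1991] S. Gelbart, J. Rogawski, Invent. Math. 105 (1991) 445–472, §3.1 p. 454 L21–27, Prop. 3.1.1
  p. 455 L1–2.
-/

set_option autoImplicit false

noncomputable section

open scoped Matrix SchwartzMap Topology ENNReal NNReal Classical
open NumberField NumberField.mixedEmbedding IsDedekindDomain Set Filter MeasureTheory

namespace Literature.NumberTheory.Weil1964

open Literature.NumberTheory.Automorphic Literature.RepresentationTheory.HeisenbergGroup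
open Literature.Analysis.SegalBargmann

attribute [local instance] secondCountableTopology_adeleRing locallyCompactSpace_adeleRing'
  secondCountableTopology_finiteAdeleRing locallyCompactSpace_finiteAdeleRing'

variable {F : Type} [Field F] [NumberField F] {n : ℕ}

/-! ## §1 The square-integrable majorant -/

/-- the archimedean coordinates of `piAdeleSplit (a, b)` are `a`. [folklore] -/
private theorem vecInfinitePart_piAdeleSplit (p : (Fin n → mixedSpace F) × (Fin n → FiniteAdeleRing (𝓞 F) F)) :
    vecInfinitePart F n (piAdeleSplit F (Fin n) p) = p.1 := by
  funext i
  rw [vecInfinitePart_apply, piAdeleSplit_apply_fst, RingEquiv.apply_symm_apply]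

/-- the finite coordinates of `piAdeleSplit (a, b)` are `b`. [folklore] -/
private theorem vecFinitePart_piAdeleSplit (p : (Fin n → mixedSpace F) × (Fin n → FiniteAdeleRing (𝓞 F) F)) :
    vecFinitePart F n (piAdeleSplit F (Fin n) p) = p.2 := rfl

/-- the pulled-back indicator is the indicator of the finite coordinate. [folklore] -/
private theorem indicator_preimage_vecFinitePart (Cf : Set (Fin n → FiniteAdeleRing (𝓞 F) F))
    (x : Fin n → AdeleRing (𝓞 F) F) :
    (vecFinitePart F n ⁻¹' Cf).indicator (1 : (Fin n → AdeleRing (𝓞 F) F) → ℝ≥0∞) x =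
      Cf.indicator 1 (vecFinitePart F n x) := by
  by_cases hx : vecFinitePart F n x ∈ Cf
  · rw [Set.indicator_of_mem (show x ∈ vecFinitePart F n ⁻¹' Cf from hx), Set.indicator_of_mem hx, Pi.one_apply,
      Pi.one_apply]
  · rw [Set.indicator_of_notMem (show x ∉ vecFinitePart F n ⁻¹' Cf from hx), Set.indicator_of_notMem hx]

/-- `(𝐀_F^∞)ⁿ` is Hausdorff. [folklore] -/
private theorem t2Space_finiteAdele_pi : T2Space (Fin n → FiniteAdeleRing (𝓞 F) F) := by
  haveI : T2Space (FiniteAdeleRing (𝓞 F) F) := inferInstanceAs (T2Space (RestrictedProduct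
    (fun v : HeightOneSpectrum (𝓞 F) => v.adicCompletion F)
    (fun v => (v.adicCompletionIntegers F : Set (v.adicCompletion F))) Filter.cofinite))
  infer_instance

variable [MeasurableSpace (AdeleRing (𝓞 F) F)] [BorelSpace (AdeleRing (𝓞 F) F)]
  (ν : Measure (Fin n → AdeleRing (𝓞 F) F)) [ν.IsAddHaarMeasure]

/-- **the majorant `C (1 + ‖x_∞‖)^{-r} 𝟙_{C_f}(x_f)` has finite integral on `𝐀_Fⁿ`** for every Haar measure `ν`, every
compact `C_f ⊆ (𝐀_F^∞)ⁿ` and `r > n [F:ℚ]` (Haar measure = `c · split_*(μ_∞ ⊗ μ_f)`; the archimedean factor by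
Mathlib's `finite_integral_one_add_norm`, the finite factor by compactness).
[cite: Weil1964, Chap. III n° 41 Lemme 5 p. 192] -/
theorem lintegral_archDecay_indicator_lt_top (C : ℝ) {r : ℝ}
    (hr : ((n * Module.finrank ℚ F : ℕ) : ℝ) < r)
    {Cf : Set (Fin n → FiniteAdeleRing (𝓞 F) F)} (hCf : IsCompact Cf) :
    ∫⁻ x, ENNReal.ofReal (C * (1 + ‖vecInfinitePart F n x‖) ^ (-r)) *
        (vecFinitePart F n ⁻¹' Cf).indicator 1 x ∂ν < ∞ := by
  letI mf : MeasurableSpace (FiniteAdeleRing (𝓞 F) F) := borel _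
  haveI : BorelSpace (FiniteAdeleRing (𝓞 F) F) := ⟨rfl⟩
  haveI : BorelSpace (Fin n → AdeleRing (𝓞 F) F) := Pi.borelSpace
  haveI : BorelSpace (Fin n → FiniteAdeleRing (𝓞 F) F) := Pi.borelSpace
  haveI : BorelSpace (Fin n → mixedSpace F) := Pi.borelSpace
  haveI : BorelSpace ((Fin n → mixedSpace F) × (Fin n → FiniteAdeleRing (𝓞 F) F)) := Prod.borelSpace
  haveI := t2Space_finiteAdele_pi (F := F) (n := n)
  obtain ⟨μM, hμM⟩ : ∃ μM : Measure (Fin n → mixedSpace F), μM.IsAddHaarMeasure :=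
    ⟨Measure.addHaarMeasure (Classical.arbitrary _), inferInstance⟩
  obtain ⟨μf, hμf⟩ : ∃ μf : Measure (Fin n → FiniteAdeleRing (𝓞 F) F), μf.IsAddHaarMeasure :=
    ⟨Measure.addHaarMeasure (Classical.arbitrary _), inferInstance⟩
  obtain ⟨c, -, hν⟩ := exists_haar_eq_smul_map_prod F (Fin n) ν μM μf
  have hCm : MeasurableSet Cf := hCf.isClosed.measurableSet
  have hmeasA : Measurable fun a : Fin n → mixedSpace F => ENNReal.ofReal (C * (1 + ‖a‖) ^ (-r)) :=
    ENNReal.measurable_ofReal.comp (measurable_const.mul ((continuous_const.add continuous_norm).measurable.pow_const _))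
  -- pull back along the splitting; in split coordinates the integrand is a product
  have e1 : ∫⁻ x, ENNReal.ofReal (C * (1 + ‖vecInfinitePart F n x‖) ^ (-r)) *
        (vecFinitePart F n ⁻¹' Cf).indicator 1 x ∂ν =
      c • ∫⁻ p : (Fin n → mixedSpace F) × (Fin n → FiniteAdeleRing (𝓞 F) F),
        ENNReal.ofReal (C * (1 + ‖p.1‖) ^ (-r)) * Cf.indicator 1 p.2 ∂(μM.prod μf) := by
    rw [hν, lintegral_smul_measure,
      show (⇑(piAdeleSplit F (Fin n)) : _ → Fin n → AdeleRing (𝓞 F) F) =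
        ⇑(piAdeleSplit F (Fin n)).toHomeomorph.toMeasurableEquiv by
          rw [Homeomorph.toMeasurableEquiv_coe]; rfl,
      lintegral_map_equiv]
    refine congrArg (fun z => c • z) (lintegral_congr fun p => ?_)
    change ENNReal.ofReal (C * (1 + ‖vecInfinitePart F n (piAdeleSplit F (Fin n) p)‖) ^ (-r)) *
        (vecFinitePart F n ⁻¹' Cf).indicator 1 (piAdeleSplit F (Fin n) p) = _
    rw [indicator_preimage_vecFinitePart, vecInfinitePart_piAdeleSplit, vecFinitePart_piAdeleSplit]
  have e2 : ∫⁻ p : (Fin n → mixedSpace F) × (Fin n → FiniteAdeleRing (𝓞 F) F),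
        ENNReal.ofReal (C * (1 + ‖p.1‖) ^ (-r)) * Cf.indicator 1 p.2 ∂(μM.prod μf) =
      (∫⁻ a, ENNReal.ofReal (C * (1 + ‖a‖) ^ (-r)) ∂μM) * ∫⁻ b, Cf.indicator 1 b ∂μf :=
    lintegral_prod_mul (μ := μM) (ν := μf) (f := fun a : Fin n → mixedSpace F => ENNReal.ofReal (C * (1 + ‖a‖) ^ (-r)))
      (g := Cf.indicator 1) hmeasA.aemeasurable (measurable_const.indicator hCm).aemeasurable
  rw [e1, e2, lintegral_indicator_one hCm]
  -- the archimedean factor is finite (`2k > dim`), the finite factor is the measure of a compact set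
  have hfin : ∫⁻ a, ENNReal.ofReal (C * (1 + ‖a‖) ^ (-r)) ∂μM < ∞ := by
    have hdim : (Module.finrank ℝ (Fin n → mixedSpace F) : ℝ) < r := by
      rw [Module.finrank_pi_fintype, Finset.sum_const, Finset.card_univ, Fintype.card_fin, smul_eq_mul,
        NumberField.mixedEmbedding.finrank]
      exact hr
    have h1 : ∀ a : Fin n → mixedSpace F, ENNReal.ofReal (C * (1 + ‖a‖) ^ (-r)) ≤
        ENNReal.ofReal |C| * ENNReal.ofReal ((1 + ‖a‖) ^ (-r)) := fun a => by
      rw [← ENNReal.ofReal_mul (abs_nonneg C)]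
      exact ENNReal.ofReal_le_ofReal (mul_le_mul_of_nonneg_right (le_abs_self C)
        (Real.rpow_nonneg (by positivity) _))
    refine lt_of_le_of_lt (lintegral_mono h1) ?_
    rw [lintegral_const_mul' _ _ ENNReal.ofReal_ne_top]
    exact ENNReal.mul_lt_top ENNReal.ofReal_lt_top (finite_integral_one_add_norm hdim)
  exact ENNReal.nnreal_smul_lt_top (ENNReal.mul_lt_top hfin hCf.measure_lt_top)

/-! ## §2 Dominated convergence: `‖ω(s h)Φ − ω(s h₀)Φ‖₂ → 0` -/

section Orbit

variable {T : Matrix (Fin n) (Fin n) (AdeleRing (𝓞 F) F)}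
  {H : Type*} [Group H] [TopologicalSpace H] [IsTopologicalGroup H] [FirstCountableTopology H]
  (hT : IsUnit T) (s : H →* adelicMpCont F (Fin n) T) (hs : Continuous s)
  (Winf : H → (𝓢((Fin n → mixedSpace F), ℂ) →L[ℂ] 𝓢((Fin n → mixedSpace F), ℂ)))
  (w0 : ∀ h, Winf h ≠ 0) (w1 : ∀ Φ, Continuous fun h => Winf h Φ)
  (w2 : ∀ (h : H) (a w : Fin n → mixedSpace F) (Φ : 𝓢((Fin n → mixedSpace F), ℂ)),
    Winf h (archModTrans F (Fin n) T a w Φ) =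
      weilPhase T (adelicMpCont.proj F (Fin n) T (s h)) (a, w) •
        archModTrans F (Fin n) T (archAct T (adelicMpCont.proj F (Fin n) T (s h)) (a, w)).1
          (archAct T (adelicMpCont.proj F (Fin n) T (s h)) (a, w)).2 (Winf h Φ))

/-- the orbit `h ↦ ω(s h)Φ` as plain functions on `𝐀_Fⁿ` (abbreviation for the proofs). [folklore] -/
private def orbitFun (s : H →* adelicMpCont F (Fin n) T) (Φ : piSchwartzBruhat F (Fin n)) (h : H) :
    (Fin n → AdeleRing (𝓞 F) F) → ℂ :=
  ((adelicMpCont.omega F (Fin n) T (s h) Φ : piSchwartzBruhat F (Fin n)) : (Fin n → AdeleRing (𝓞 F) F) → ℂ)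

include hT hs w0 w1 w2 in
/-- dominated convergence for the orbit functions (private form of `tendsto_eLpNorm_omega_comp_sub`).
[cite: Weil1964, Chap. III n° 41 Lemme 5 p. 192] -/
private theorem tendsto_eLpNorm_orbitFun_sub (Φ : piSchwartzBruhat F (Fin n)) (h₀ : H) :
    Tendsto (fun h => eLpNorm (orbitFun s Φ h - orbitFun s Φ h₀) 2 ν) (𝓝 h₀) (𝓝 0) := by
  haveI : BorelSpace (Fin n → AdeleRing (𝓞 F) F) := Pi.borelSpace
  haveI := t2Space_finiteAdele_pi (F := F) (n := n)
  -- Weil's decay near `h₀`, with exponent `k > n [F:ℚ]`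
  have hk2 : ((n * Module.finrank ℚ F : ℕ) : ℝ) < ((2 * (n * Module.finrank ℚ F + 1) : ℕ) : ℝ) := by
    push_cast
    nlinarith
  have hd := decay_near hT s (map_mul s) hs Winf w0 w1 w2 Φ (n * Module.finrank ℚ F + 1) h₀
  rcases hd with ⟨V, hV, M, Cf, hM, hCf, hdec⟩
  have hh₀ : h₀ ∈ V := mem_of_mem_nhds hV
  -- continuity of the matrix coefficients, continuity of the orbit functions, coordinates
  have hcoef : ∀ x, Continuous fun h => orbitFun s Φ h x := fun x =>
    (adelicMpCont.continuous_omega_apply Φ x).comp hs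
  have hΨc : ∀ h, Continuous (orbitFun s Φ h) := fun h =>
    continuous_of_mem_piSchwartzBruhat (adelicMpCont.omega F (Fin n) T (s h) Φ).2
  have hcinf : Continuous (vecInfinitePart F n) :=
    continuous_pi fun i => (continuous_ringEquiv_mixedSpace F).comp (continuous_fst.comp (continuous_apply i))
  have hcfin : Continuous (vecFinitePart F n) := continuous_pi fun i => continuous_snd.comp (continuous_apply i)
  -- the pointwise bound near `h₀` by the square-integrable majorant
  have hptw : ∀ h ∈ V, ∀ x, ‖orbitFun s Φ h x - orbitFun s Φ h₀ x‖ₑ ^ (2 : ℝ) ≤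
      ENNReal.ofReal ((2 * M) ^ 2 * (1 + ‖vecInfinitePart F n x‖) ^ (-(((2 * (n * Module.finrank ℚ F + 1) : ℕ) : ℝ)))) *
        (vecFinitePart F n ⁻¹' Cf).indicator 1 x := by
    intro h hh x
    by_cases hx : vecFinitePart F n x ∈ Cf
    · have hb : ‖orbitFun s Φ h x - orbitFun s Φ h₀ x‖ ≤
          2 * M * (1 + ‖vecInfinitePart F n x‖) ^ (-((n * Module.finrank ℚ F + 1 : ℕ) : ℝ)) := by
        refine (norm_sub_le _ _).trans ?_
        have h1 := (hdec h hh).1 x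
        have h2 := (hdec h₀ hh₀).1 x
        change ‖orbitFun s Φ h x‖ ≤ _ at h1
        change ‖orbitFun s Φ h₀ x‖ ≤ _ at h2
        linarith
      have hb' : ‖orbitFun s Φ h x - orbitFun s Φ h₀ x‖ ^ (2 : ℝ) ≤
          (2 * M) ^ 2 * (1 + ‖vecInfinitePart F n x‖) ^ (-(((2 * (n * Module.finrank ℚ F + 1) : ℕ) : ℝ))) := by
        have hpos : 0 ≤ 2 * M * (1 + ‖vecInfinitePart F n x‖) ^ (-((n * Module.finrank ℚ F + 1 : ℕ) : ℝ)) :=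
          mul_nonneg (by linarith) (Real.rpow_nonneg (by positivity) _)
        have h3 : ‖orbitFun s Φ h x - orbitFun s Φ h₀ x‖ ^ (2 : ℝ) ≤
            (2 * M * (1 + ‖vecInfinitePart F n x‖) ^ (-((n * Module.finrank ℚ F + 1 : ℕ) : ℝ))) ^ (2 : ℝ) :=
          Real.rpow_le_rpow (norm_nonneg _) hb (by norm_num)
        refine h3.trans_eq ?_
        rw [Real.mul_rpow (by linarith) (Real.rpow_nonneg (by positivity) _), ← Real.rpow_mul (by positivity),
          Real.rpow_two]
        congr 2
        push_cast
        ring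
      rw [Set.indicator_of_mem (show x ∈ vecFinitePart F n ⁻¹' Cf from hx), Pi.one_apply, mul_one,
        ← ofReal_norm, ENNReal.ofReal_rpow_of_nonneg (norm_nonneg _) (by norm_num)]
      exact ENNReal.ofReal_le_ofReal hb'
    · have h1 : orbitFun s Φ h x = 0 := (hdec h hh).2 x hx
      have h2 : orbitFun s Φ h₀ x = 0 := (hdec h₀ hh₀).2 x hx
      rw [h1, h2, sub_zero, enorm_zero, ENNReal.zero_rpow_of_pos (by norm_num)]
      exact bot_le
  -- dominated convergence for `∫⁻ ‖Ψ h − Ψ h₀‖ₑ²`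
  have hlim : Tendsto (fun h => ∫⁻ x, ‖orbitFun s Φ h x - orbitFun s Φ h₀ x‖ₑ ^ (2 : ℝ) ∂ν) (𝓝 h₀)
      (𝓝 (∫⁻ _ : Fin n → AdeleRing (𝓞 F) F, (0 : ℝ≥0∞) ∂ν)) := by
    refine tendsto_lintegral_filter_of_dominated_convergence (fun x =>
      ENNReal.ofReal ((2 * M) ^ 2 * (1 + ‖vecInfinitePart F n x‖) ^ (-(((2 * (n * Module.finrank ℚ F + 1) : ℕ) : ℝ)))) *
        (vecFinitePart F n ⁻¹' Cf).indicator 1 x) ?_ ?_ ?_ ?_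
    · exact Eventually.of_forall fun h => ((hΨc h).sub (hΨc h₀)).measurable.enorm.pow_const _
    · exact Filter.eventually_of_mem hV fun h hh => ae_of_all ν (hptw h hh)
    · exact (lintegral_archDecay_indicator_lt_top ν ((2 * M) ^ 2) hk2 hCf).ne
    · refine Eventually.of_forall fun x => ?_
      have hc : Continuous fun h => ‖orbitFun s Φ h x - orbitFun s Φ h₀ x‖ₑ ^ (2 : ℝ) :=
        ENNReal.continuous_rpow_const.comp ((hcoef x).sub continuous_const).enorm
      have ht := hc.tendsto h₀
      rwa [sub_self, enorm_zero, ENNReal.zero_rpow_of_pos (by norm_num : (0 : ℝ) < 2)] at ht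
  rw [lintegral_zero] at hlim
  -- back to `eLpNorm`
  have e : ∀ h, eLpNorm (orbitFun s Φ h - orbitFun s Φ h₀) 2 ν =
      (∫⁻ x, ‖orbitFun s Φ h x - orbitFun s Φ h₀ x‖ₑ ^ (2 : ℝ) ∂ν) ^ (1 / (2 : ℝ)) := fun h => by
    rw [eLpNorm_eq_lintegral_rpow_enorm_toReal two_ne_zero ENNReal.ofNat_ne_top, ENNReal.toReal_ofNat]
    rfl
  have h12 : Tendsto (fun r : ℝ≥0∞ => r ^ (1 / (2 : ℝ))) (𝓝 0) (𝓝 0) := by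
    have ht := (ENNReal.continuous_rpow_const (y := 1 / (2 : ℝ))).tendsto 0
    rwa [ENNReal.zero_rpow_of_pos (by norm_num : (0 : ℝ) < 1 / 2)] at ht
  exact (h12.comp hlim).congr fun h => (e h).symm

include hT hs w0 w1 w2 in
/-- **`‖ω(s h)Φ − ω(s h₀)Φ‖_{L²(ν)} → 0` as `h → h₀`** for every `Φ ∈ 𝒮(𝐀_Fⁿ)` and every Haar measure `ν` on `𝐀_Fⁿ`:
Weil's locally uniform decay (`decay_near`, Lemme 5) gives a square-integrable majorant near `h₀`, the matrix coefficients
`h ↦ (ω(s h)Φ)(x)` are continuous, and dominated convergence applies along the countably generated filter `𝓝 h₀`.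
[cite: Weil1964, Chap. III n° 41 Lemme 5 p. 192, n° 39 p. 189; GelbartRogawski1991, §3.1 p. 454 L21–27] -/
theorem tendsto_eLpNorm_omega_comp_sub (Φ : piSchwartzBruhat F (Fin n)) (h₀ : H) :
    Tendsto (fun h => eLpNorm
        (((adelicMpCont.omega F (Fin n) T (s h) Φ : piSchwartzBruhat F (Fin n)) : (Fin n → AdeleRing (𝓞 F) F) → ℂ) -
          ((adelicMpCont.omega F (Fin n) T (s h₀) Φ : piSchwartzBruhat F (Fin n)) : (Fin n → AdeleRing (𝓞 F) F) → ℂ))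
        2 ν) (𝓝 h₀) (𝓝 0) :=
  tendsto_eLpNorm_orbitFun_sub ν hT s hs Winf w0 w1 w2 Φ h₀

/-! ## §3 Strong continuity in `L²` along `s` -/

include hT hs w0 w1 w2 in
/-- **`h ↦ [ω(s h) Φ]` is continuous in `L²(𝐀_Fⁿ, ν)`** for every `Φ ∈ 𝒮(𝐀_Fⁿ)`: for any linear map
`i : 𝒮(𝐀_Fⁿ) →ₗ[ℂ] L²(ν)` sending a Schwartz–Bruhat function to its class (`i Φ =ᵐ Φ`), the orbit map `h ↦ i (ω(s h) Φ)` is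
continuous — the strong continuity of the Weil representation along `s` on the Hilbert space of print's `ρ_ψ`.
[cite: Weil1964, Chap. III n° 39 p. 189, n° 41 Lemme 5 p. 192; GelbartRogawski1991, §3.1 p. 454 L21–27, Prop. 3.1.1
p. 455 L1–2] -/
theorem continuous_toL2_omega_comp (i : piSchwartzBruhat F (Fin n) →ₗ[ℂ] Lp ℂ 2 ν)
    (hi : ∀ Φ : piSchwartzBruhat F (Fin n),
      ((i Φ : Lp ℂ 2 ν) : (Fin n → AdeleRing (𝓞 F) F) → ℂ) =ᵐ[ν] (Φ : (Fin n → AdeleRing (𝓞 F) F) → ℂ))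
    (Φ : piSchwartzBruhat F (Fin n)) :
    Continuous fun h => i (adelicMpCont.omega F (Fin n) T (s h) Φ) := by
  refine continuous_iff_continuousAt.2 fun h₀ => tendsto_iff_norm_sub_tendsto_zero.2 ?_
  have e : ∀ h, ‖i (adelicMpCont.omega F (Fin n) T (s h) Φ) - i (adelicMpCont.omega F (Fin n) T (s h₀) Φ)‖ =
      (eLpNorm (orbitFun s Φ h - orbitFun s Φ h₀) 2 ν).toReal := fun h =>
    (congrArg norm (map_sub i _ _)).symm.trans
      ((Lp.norm_def _).trans (congrArg ENNReal.toReal (eLpNorm_congr_ae (hi _))))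
  exact ((ENNReal.tendsto_toReal ENNReal.zero_ne_top).comp
    (tendsto_eLpNorm_orbitFun_sub ν hT s hs Winf w0 w1 w2 Φ h₀)).congr fun h => (e h).symm

end Orbit

end Literature.NumberTheory.Weil1964

end
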